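import Mathlib
import Literature.NumberTheory.NumberFields.PureCubicNormCubicResidue
import HarnessLib

/-!
# Pure cubic fields: ideal classes detected by cubic residues of norms

Topic `NumberTheory/NumberFields`.  Theorem-only file (no definition, no named fact, D-0026),
unconditional; continuation of `PureCubicNormCubicResidue.lean` (Ishida's Lemma 4:
`N_{K/ℚ}(γ) ≡ c³ (mod ℓ)` for `γ ∈ 𝓞_K`, `K ∋ ∛m` cubic, `3 ∤ v_ℓ(m)`).  The RATIONAL genus
character `𝔞 ↦ (N𝔞 / ℓ)₃ ∈ (ℤ/ℓ)ˣ/(ℤ/ℓ)ˣ³ ≅ ℤ/3` of Barrucand–Cohn is trivial on principal ideals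
prime to `ℓ`; hence:

* `Honda1971.exists_units_pow_three_eq_norm` — for `ℓ ∤ N(γ)`, `N(γ)` is a cube in `(ℤ/ℓ)ˣ`;
* `Honda1971.three_dvd_of_pow_isPrincipal` — if `𝔞` is prime to `ℓ`, `N𝔞` is not a cube mod `ℓ`
  (`ℓ ≡ 1 (mod 3)`) and `𝔞^k` is principal, then `3 ∣ k`;
* `Honda1971.three_dvd_orderOf_mk0` — **the ideal class of such an `𝔞` has order divisible by
  `3`** (so `𝔞` is not principal and `3 ∣ h(K)`, with an explicit witness class).

> P. Barrucand, H. Cohn, *A rational genus, class number divisibility, and unit theory for pure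
> cubic fields*, J. Number Theory 2 (1970) 7–21; M. Ishida, LNM 555 (1976), Ch. 2 Lemma 4 and
> Ch. 4 (genus characters `ω_p ∘ N`).

## References

* P. Barrucand, H. Cohn, J. Number Theory 2 (1970) 7–21. [BarrucandCohn1970]
* M. Ishida, *The genus fields of algebraic number fields*, LNM 555 (1976), Ch. 2 Lemma 4. [Ishida1976]
-/

noncomputable section

open Polynomial NumberField IsDedekindDomain
open scoped IntermediateField nonZeroDivisors

namespace Literature.NumberTheory.NumberFields

namespace Honda1971

variable {K : Type*} [Field K] [NumberField K]

/-! ### Consequences: cubic residues, non-principal ideals, classes of order divisible by `3` -/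

/-- **Norms prime to `ℓ` are cubic residues**: for `γ ∈ 𝓞_K` with `ℓ ∤ N(γ)`, the residue of
`N(γ)` is a cube in `(ℤ/ℓ)ˣ`. [cite: BarrucandCohn1970] [cite: Ishida1976, Ch. 2 Lemma 4] -/
theorem exists_units_pow_three_eq_norm {ℓ m : ℕ} (hℓ : ℓ.Prime) (hm : ¬ 3 ∣ padicValNat ℓ m)
    (h3 : Module.finrank ℚ K = 3) {α : K} (hα : α ^ 3 = (m : K)) (γ : 𝓞 K)
    (hγ : ¬ (ℓ : ℤ) ∣ Algebra.norm ℤ γ) :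
    ∃ u : (ZMod ℓ)ˣ, (u : ZMod ℓ) ^ 3 = (Algebra.norm ℤ γ : ZMod ℓ) := by
  haveI : Fact ℓ.Prime := ⟨hℓ⟩
  obtain ⟨c, hc⟩ := exists_natCast_dvd_norm_sub_pow_three hℓ hm h3 hα γ
  have hc' : ((c : ZMod ℓ)) ^ 3 = (Algebra.norm ℤ γ : ZMod ℓ) := by
    have h := (ZMod.intCast_zmod_eq_zero_iff_dvd _ ℓ).mpr hc
    push_cast at h
    linear_combination -h
  have hc0 : (c : ZMod ℓ) ≠ 0 := by
    intro h0
    rw [h0, zero_pow (by norm_num)] at hc'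
    exact hγ ((ZMod.intCast_zmod_eq_zero_iff_dvd _ ℓ).mp hc'.symm)
  exact ⟨Units.mk0 _ hc0, hc'⟩

/-- **An ideal prime to `ℓ` whose norm is not a cube mod `ℓ` has no principal power of exponent
prime to `3`**: if `𝔞^k` is principal then `3 ∣ k`.  (The norm of `𝔞^k = (γ)` is `|N(γ)| ≡ ±c³`,
a cube mod `ℓ`, while the cubes have index `3` in `(ℤ/ℓ)ˣ` for `ℓ ≡ 1 (mod 3)`.)
[cite: BarrucandCohn1970] -/
theorem three_dvd_of_pow_isPrincipal {ℓ m : ℕ} (hℓ : ℓ.Prime) (hℓ1 : ℓ % 3 = 1)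
    (hm : ¬ 3 ∣ padicValNat ℓ m) (h3 : Module.finrank ℚ K = 3) {α : K} (hα : α ^ 3 = (m : K))
    {I : Ideal (𝓞 K)} (hIℓ : ¬ ℓ ∣ Ideal.absNorm I)
    (hI : ∀ u : (ZMod ℓ)ˣ, (u : ZMod ℓ) ^ 3 ≠ (Ideal.absNorm I : ZMod ℓ)) {k : ℕ}
    (hk : (I ^ k).IsPrincipal) : 3 ∣ k := by
  classical
  haveI : Fact ℓ.Prime := ⟨hℓ⟩
  obtain ⟨γ, hγ⟩ := (Submodule.isPrincipal_iff _).mp hk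
  -- `N(I)^k = |N(γ)|` is `±` a cube, hence a cube, mod `ℓ`
  have hnormk : Ideal.absNorm I ^ k = (Algebra.norm ℤ γ).natAbs := by
    have h := congrArg Ideal.absNorm hγ
    rwa [map_pow, Ideal.submodule_span_eq, Ideal.absNorm_span_singleton] at h
  have hγℓ : ¬ (ℓ : ℤ) ∣ Algebra.norm ℤ γ := by
    intro h
    have h' : ℓ ∣ Ideal.absNorm I ^ k := by
      rw [hnormk]; exact Int.natCast_dvd.mp h
    exact hIℓ (hℓ.dvd_of_dvd_pow h')
  obtain ⟨u, hu⟩ := exists_units_pow_three_eq_norm hℓ hm h3 hα γ hγℓ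
  -- the unit `a = N(I) mod ℓ` and the cube `a^k = ±u³`
  have ha0 : (Ideal.absNorm I : ZMod ℓ) ≠ 0 := by
    intro h0
    exact hIℓ ((ZMod.natCast_eq_zero_iff _ _).mp h0)
  set a : (ZMod ℓ)ˣ := Units.mk0 _ ha0 with hadef
  have hak : ∃ w : (ZMod ℓ)ˣ, w ^ 3 = a ^ k := by
    have hsign : (Algebra.norm ℤ γ : ZMod ℓ) = ((Algebra.norm ℤ γ).natAbs : ZMod ℓ) ∨
        (Algebra.norm ℤ γ : ZMod ℓ) = -((Algebra.norm ℤ γ).natAbs : ZMod ℓ) := by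
      rcases Int.natAbs_eq (Algebra.norm ℤ γ) with h | h
      · left
        exact (congrArg (fun z : ℤ => (z : ZMod ℓ)) h).trans (Int.cast_natCast _)
      · right
        refine (congrArg (fun z : ℤ => (z : ZMod ℓ)) h).trans ?_
        rw [Int.cast_neg, Int.cast_natCast]
    have hak' : ((a ^ k : (ZMod ℓ)ˣ) : ZMod ℓ) = ((Algebra.norm ℤ γ).natAbs : ZMod ℓ) := by
      rw [Units.val_pow_eq_pow_val, hadef, Units.val_mk0, ← Nat.cast_pow, hnormk]
    rcases hsign with h | h
    · refine ⟨u, Units.ext ?_⟩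
      rw [Units.val_pow_eq_pow_val, hu, h, hak']
    · refine ⟨-u, Units.ext ?_⟩
      rw [Units.val_pow_eq_pow_val, Units.val_neg, neg_pow, hu, hak', h]
      ring
  -- in `(ℤ/ℓ)ˣ` the cubes have index `3`; `a` is not a cube but `a^k` is, so `3 ∣ k`
  obtain ⟨w, hw⟩ := hak
  have hidx : (powMonoidHom 3 : (ZMod ℓ)ˣ →* (ZMod ℓ)ˣ).range.index = 3 := by
    rw [IsCyclic.index_powMonoidHom_range, Nat.card_eq_fintype_card, ZMod.card_units_eq_totient,
      Nat.totient_prime hℓ]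
    have h3' : 3 ∣ ℓ - 1 := by have := hℓ.two_le; omega
    exact Nat.gcd_eq_right h3'
  have hanot : a ∉ (powMonoidHom 3 : (ZMod ℓ)ˣ →* (ZMod ℓ)ˣ).range := by
    rintro ⟨u', hu'⟩
    rw [powMonoidHom_apply] at hu'
    apply hI u'
    rw [← Units.val_pow_eq_pow_val, hu', hadef, Units.val_mk0]
  have hakmem : a ^ k ∈ (powMonoidHom 3 : (ZMod ℓ)ˣ →* (ZMod ℓ)ˣ).range := ⟨w, hw⟩
  -- the class of `a` in the quotient of order `3` is nontrivial and killed by `k`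
  set H := (powMonoidHom 3 : (ZMod ℓ)ˣ →* (ZMod ℓ)ˣ).range with hHdef
  have hord : orderOf (QuotientGroup.mk (s := H) a) = 3 := by
    have hdvd : orderOf (QuotientGroup.mk (s := H) a) ∣ 3 := by
      rw [← hidx, Subgroup.index]
      exact orderOf_dvd_natCard _
    rcases (Nat.dvd_prime Nat.prime_three).mp hdvd with h1 | h3'
    · exfalso
      rw [orderOf_eq_one_iff, QuotientGroup.eq_one_iff] at h1
      exact hanot h1
    · exact h3'
  rw [← hord]
  apply orderOf_dvd_of_pow_eq_one
  rw [← QuotientGroup.mk_pow, QuotientGroup.eq_one_iff]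
  exact hakmem

/-- **Ideal classes detected by norm residues.**  For a nonzero ideal `𝔞` of `𝓞_K` prime to `ℓ`
whose norm is not a cubic residue mod `ℓ` (`ℓ ≡ 1 (mod 3)`, `3 ∤ v_ℓ(m)`), the order of the class
`[𝔞] ∈ Cl(K)` is divisible by `3`; in particular `𝔞` is not principal and `3 ∣ h(K)`.
[cite: BarrucandCohn1970] -/
theorem three_dvd_orderOf_mk0 {ℓ m : ℕ} (hℓ : ℓ.Prime) (hℓ1 : ℓ % 3 = 1)
    (hm : ¬ 3 ∣ padicValNat ℓ m) (h3 : Module.finrank ℚ K = 3) {α : K} (hα : α ^ 3 = (m : K))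
    (I : (Ideal (𝓞 K))⁰) (hIℓ : ¬ ℓ ∣ Ideal.absNorm (I : Ideal (𝓞 K)))
    (hI : ∀ u : (ZMod ℓ)ˣ, (u : ZMod ℓ) ^ 3 ≠ (Ideal.absNorm (I : Ideal (𝓞 K)) : ZMod ℓ)) :
    3 ∣ orderOf (ClassGroup.mk0 I) := by
  classical
  refine three_dvd_of_pow_isPrincipal hℓ hℓ1 hm h3 hα hIℓ hI (k := orderOf (ClassGroup.mk0 I)) ?_
  have h1 : ClassGroup.mk0 (I ^ orderOf (ClassGroup.mk0 I)) = 1 := by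
    rw [map_pow, pow_orderOf_eq_one]
  have hmem : ((I : Ideal (𝓞 K)) ^ orderOf (ClassGroup.mk0 I)) ∈ (Ideal (𝓞 K))⁰ :=
    (I ^ orderOf (ClassGroup.mk0 I)).2
  have h2 : ClassGroup.mk0 ⟨(I : Ideal (𝓞 K)) ^ orderOf (ClassGroup.mk0 I), hmem⟩ = 1 := by
    have : (⟨(I : Ideal (𝓞 K)) ^ orderOf (ClassGroup.mk0 I), hmem⟩ : (Ideal (𝓞 K))⁰) =
        I ^ orderOf (ClassGroup.mk0 I) := Subtype.ext (SubmonoidClass.coe_pow I _).symm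
    rw [this]; exact h1
  exact (ClassGroup.mk0_eq_one_iff hmem).mp h2

end Honda1971

end Literature.NumberTheory.NumberFields

end
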